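/-
Copyright (c) 2026 the pub-hodgecm-mathlib formalisation cell (harness21).  Prover seat hodgecm-mathlib-K2Liu-p09 (g3): Track B «K2-LIT», #184♮ = hLiu418,
payer-internal organ O4b «BOUNDED PARTIAL EULER PRODUCTS OF `∫|Λ_v|`» of file #34 `Theorems/K2LiuDoublingZetaGL1.lean` (LEAD F0P6-plan (g10) DEAL K2/STATUS
2026-09-04T02:36:29Z; REPORT-FIRST #34 v3, K2/K2Liu-p09/g3; DEPMAP v2.5 §10 step (Λbd)).
-/
import Literature.NumberTheory.Automorphic.AutomorphicLFunctionProofs   -- ★ `summable_residueCard_rpow_neg`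
import HarnessLib

/-!
# Crux `HLiu418`, Track B road `K2_Liu`, file #34 — organ O4b «`∏_{v ∈ T} ∫|Λ_v| ≤ B` UNIFORMLY IN THE FINITE SET `T` OF GOOD PLACES»

Cell `hodgecm-mathlib`, crux item hLiu418 = `stmt-HodgeConjecture-24832`, route of record `HCCMUnconditional`; squad K2 ∕ K2Liu, prover K2Liu-p09 (g3).
THEOREMS ONLY (no `def`, no instance, no notation, no named-fact hypothesis, no `sorry`, default heartbeats); lane
`--supports stmt-HodgeConjecture-24832 --as helper` (count-neutral).

★ #29s `sig_K2LiuDoublingPartialEuler` (p856804) asks for `_hΛbd : ∃ B, ∀ T : Finset {v ∉ S}, ∏_{v ∈ T} ∫ ‖Λ_v‖ ∂ν_v ≤ B`.  The per-place inputs are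
★ O4 `K2LiuDoublingZetaGL1LambdaSplit.exists_integral_norm_lambdaLoc_le` (split `v`: `∫‖Λ_v‖ ≤ 1 + C·q_w^{−Re s}`, `q_w = q_v`) and the inert socket
(`∫‖Λ_v‖ ≤ 1 + 4·q_v^{−2 Re s}`).  This file is the elementary assembly: `0 ≤ x_v ≤ 1 + c_v`, `c ≥ 0` summable ⟹ `∏_{v ∈ T} x_v ≤ exp(∑' c_v)` (`1 + c ≤ e^c`),
and `∑_v q_v^{−σ} < ∞` for `σ > 1` over the finite places of a number field (★ `summable_residueCard_rpow_neg`), with the exponent bookkeeping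
`q^{−σ'} ≤ q^{−σ}` (`σ ≤ σ'`, `1 ≤ q`) that lets the inert bound (`2 Re s`) ride on the split one (`Re s`).

HONEST LABEL: HC_CM is proved only modulo the printed citations (2 remaining named inputs: hLiu418 = stmt-HodgeConjecture-24832,
h413 = stmt-HodgeConjecture-24833) until rung 0 closes; this file is bookkeeping toward socket s23 and closes no item.
References: [Li1992] §3 (convergence of the unramified doubling Euler product); [Liu2011] §2B Prop. 2.3 p. 862; Lang, *ANT* VIII §2.
-/

set_option autoImplicit false
set_option linter.dupNamespace false

noncomputable section

open NumberField IsDedekindDomain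
open Literature.NumberTheory.Automorphic Literature.NumberTheory.GaloisRepresentations

namespace Summit.HodgeConjecture.HodgeConjecture.Cruxes.HLiu418.K2LiuDoublingZetaGL1LambdaProd

/-- **`∏_{i ∈ T} x_i ≤ exp(∑' c)`** when `0 ≤ x_i ≤ 1 + c_i` with `c ≥ 0` summable (`1 + c ≤ e^c`, `∑_{T} c ≤ ∑' c`). [folklore] -/
theorem prod_le_exp_tsum {ι : Type*} {x c : ι → ℝ} (hx : ∀ i, 0 ≤ x i) (hxc : ∀ i, x i ≤ 1 + c i) (hc0 : ∀ i, 0 ≤ c i)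
    (hc : Summable c) (T : Finset ι) : ∏ i ∈ T, x i ≤ Real.exp (∑' i, c i) :=
  calc ∏ i ∈ T, x i ≤ ∏ i ∈ T, Real.exp (c i) :=
        Finset.prod_le_prod (fun i _ => hx i) fun i _ => (hxc i).trans (by linarith [Real.add_one_le_exp (c i)])
    _ = Real.exp (∑ i ∈ T, c i) := (Real.exp_sum _ _).symm
    _ ≤ Real.exp (∑' i, c i) := Real.exp_le_exp.2 (hc.sum_le_tsum T fun i _ => hc0 i)

/-- exponent bookkeeping: **`q^{−σ'} ≤ q^{−σ}` for `1 ≤ q`, `σ ≤ σ'`** (the inert bound `q_v^{−2 Re s}` rides on `q_v^{−Re s}`). [folklore] -/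
theorem rpow_neg_le_rpow_neg_of_le {q σ σ' : ℝ} (hq : 1 ≤ q) (h : σ ≤ σ') : q ^ (-σ') ≤ q ^ (-σ) :=
  Real.rpow_le_rpow_of_exponent_le hq (neg_le_neg h)

/-- **`1 ≤ q_v`** for a finite place `v` (`q_v ≥ 2`). [folklore] -/
theorem one_le_residueCard {F : Type*} [Field F] [NumberField F] (v : HeightOneSpectrum (𝓞 F)) : (1 : ℝ) ≤ (v.residueCard : ℝ) := by
  exact_mod_cast (HeightOneSpectrum.one_lt_residueCard v).le

/-- **ORGAN O4b OF #34 — ★ #29s's `_hΛbd`.**  If off the finite set `S` every `X_v ≥ 0` (in #34: `X_v = ∫ ‖Λ_v‖ ∂ν_v`) satisfies `X_v ≤ 1 + C·q_v^{−σ_v}` with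
`σ_v ≥ σ > 1` and `C ≥ 0`, then the partial products `∏_{v ∈ T} X_v` over finite sets `T` of places off `S` are bounded, by `exp(C ∑_v q_v^{−σ})`.
[cite: Li1992, §3 Thm. 3.1] [cite: Liu2011, §2B Prop. 2.3 p. 862] -/
theorem exists_bound_finsetProd {F : Type} [Field F] [NumberField F] (S : Finset (HeightOneSpectrum (𝓞 F))) {σ C : ℝ} (hσ : 1 < σ) (hC : 0 ≤ C)
    (X : HeightOneSpectrum (𝓞 F) → ℝ) (h0 : ∀ v, v ∉ S → 0 ≤ X v)
    (hle : ∀ v, v ∉ S → ∃ σ' : ℝ, σ ≤ σ' ∧ X v ≤ 1 + C * (v.residueCard : ℝ) ^ (-σ')) :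
    ∃ B : ℝ, ∀ T : Finset {v : HeightOneSpectrum (𝓞 F) // v ∉ S}, ∏ v ∈ T, X v.1 ≤ B := by
  refine ⟨Real.exp (∑' v : {v : HeightOneSpectrum (𝓞 F) // v ∉ S}, C * (v.1.residueCard : ℝ) ^ (-σ)), fun T =>
    prod_le_exp_tsum (fun v => h0 v.1 v.2) (fun v => ?_) (fun v => mul_nonneg hC (Real.rpow_nonneg (Nat.cast_nonneg _) _))
      (((summable_residueCard_rpow_neg hσ).mul_left C).comp_injective Subtype.val_injective) T⟩
  obtain ⟨σ', hσ', hv⟩ := hle v.1 v.2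
  linarith [mul_le_mul_of_nonneg_left (rpow_neg_le_rpow_neg_of_le (one_le_residueCard v.1) hσ') hC]

/-- the same with ONE exponent (`σ' = σ` everywhere). [cite: Li1992, §3 Thm. 3.1] -/
theorem exists_bound_finsetProd' {F : Type} [Field F] [NumberField F] (S : Finset (HeightOneSpectrum (𝓞 F))) {σ C : ℝ} (hσ : 1 < σ) (hC : 0 ≤ C)
    (X : HeightOneSpectrum (𝓞 F) → ℝ) (h0 : ∀ v, v ∉ S → 0 ≤ X v)
    (hle : ∀ v, v ∉ S → X v ≤ 1 + C * (v.residueCard : ℝ) ^ (-σ)) :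
    ∃ B : ℝ, ∀ T : Finset {v : HeightOneSpectrum (𝓞 F) // v ∉ S}, ∏ v ∈ T, X v.1 ≤ B :=
  exists_bound_finsetProd S hσ hC X h0 fun v hv => ⟨σ, le_rfl, hle v hv⟩

end Summit.HodgeConjecture.HodgeConjecture.Cruxes.HLiu418.K2LiuDoublingZetaGL1LambdaProd

end
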